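import Summits.QuantumFields.BalabanUV.Beta.FP.NestedStepLawSliced
import Summits.QuantumFields.BalabanUV.Beta.FP.EffectiveFormJetsMovingBorder

/-!
# The nested step law for sliced systems AT JET LEVEL: every jet displayed, curves optional (road «FP», route T row (T-INST-j))

Owner file of road «FP» (unit `b2b-balaban-beta-d1-p3`, gen 16), ruling R-FP-51 (journal l.35984, «ROUTE T»): the (STEP) door's kernel instance is
obtained by instantiating the model theorem `NestedStepLawSliced.secondVar_nestedStepLaw_sliced` (p303855) ON THE TORUS, where the three sliced
bordered systems — composite `(𝔎, 𝔔) = (H + Q₁ᵀGQ₁, [[Q₂Q₁; τ₂Q₁]; τ₁])`, fine one-step `(H, [Q₁;τ₁])`, block `(E, P̃) = (effForm H [Q₁;τ₁] + (G ⊕ 0), [[Q₂,0],[τ₂,0],[0,1]])` —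
are FINITE matrices (periodised level-`j` tables) and their background jets are finite matrices too (periodised insertion families, row (T-ID)).

`secondVar_nestedStepLaw_sliced` takes the jets of the composite curves `𝔎, 𝔔` and of the block curve `E` as HYPOTHESES (curves `𝔎₁, 𝔔₁, E₁` and matrices
`𝔎₂, 𝔔₂, E₂` with coincidence hypotheses near `0`).  This file DISCHARGES them: from `C²` data `H, Q₁, Q₂, G` alone it
* computes the first and second jets of the composite border `[[Q₂Q₁; τ₂Q₁]; τ₁]` (§1) and of the composite form `H + Q₁ᵀGQ₁` (§2, from
  `NestedStepLawMovingBorder` §5),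
* computes the first and second jets of the block curve `E = 𝔊 + (G ⊕ 0)` from `EffectiveFormJetsMovingBorder` (§3; words in the blocks `Γ, 𝓘, 𝓘ᴸ, 𝔊` of
  the inverse of the fine sliced system at `0`),
* and states the nested step law with EVERY JET DISPLAYED and only the two non-degeneracy hypotheses at `u = 0` left besides the `C²` data (§4),
* with the corollary for QUADRATIC POLYNOMIAL curves `X₀ + uX₁ + ½u²X₂` (§5): twelve matrices `(H₀,H₁,H₂)`, `(Q₁₀,Q₁₁,Q₁₂)`, `(Q₂₀,Q₂₁,Q₂₂)`, `(G₀,G₁,G₂)`, two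
  static slices `τ₁, τ₂`, two invertibilities — NO analysis hypothesis at all.  This is the shape the torus instance (T-INST-j) and the identification row
  (T-ID) type against: identify the periodised road tables and insertion families with these matrices.
HONEST: finite-dimensional calculus, every index type generic; nothing here is the road's (SDF), (D1), BetaPertH, a continuum statement or Clay. -/

noncomputable section
namespace Summit.QuantumFields.BalabanUV.Beta.FP.NestedStepLawJets

open Matrix Filter Finset
open scoped Topology
open Literature.MathematicalPhysics.QuantumFieldTheory.Balaban1983to89.Beta.Composition (kkt)
open Literature.MathematicalPhysics.QuantumFieldTheory.Balaban1983to89.Beta.CompositionSingular (effForm flucCov minOp minOpL)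
open Summit.QuantumFields.BalabanUV.Beta.D1BFx.LogDetSecondVariation (secondVar)
open Summit.QuantumFields.BalabanUV.Beta.D1BFx.SliceTransferModel (hasDerivAt_entry hasDerivAt_matMul hasDerivAt_transpose)
open Summit.QuantumFields.BalabanUV.Beta.FP.NestedStepLawMovingBorder (hasDerivAt_sandwich_curves hasDerivAt_compForm_curves_jet)
open Summit.QuantumFields.BalabanUV.Beta.FP.NestedStepLawSliced (hasDerivAt_blockDiag secondVar_nestedStepLaw_sliced)
open Summit.QuantumFields.BalabanUV.Beta.FP.EffectiveFormJetsMovingBorder (eventually_hasDerivAt_effForm hasDerivAt_effFormJet)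

/-! ## §1 Jets of the composite sliced border `[[Q₂Q₁; τ₂Q₁]; τ₁]` -/

section Border

variable {ν μ κ ρ₁ ρ₂ : Type*} [Fintype ν] [Fintype μ] [Fintype κ]

/-- [folklore] a static left factor: `u ↦ τ·Q(u)` has derivative `τ·Q̇`. -/
theorem hasDerivAt_const_mul {Q : ℝ → μ → ν → ℝ} {Q' : Matrix μ ν ℝ} {t : ℝ} (τ : Matrix ρ₂ μ ℝ) (hQ : HasDerivAt Q (Matrix.of.symm Q') t) :
    HasDerivAt (fun u => Matrix.of.symm (τ * Matrix.of (Q u))) (Matrix.of.symm (τ * Q')) t := by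
  refine hasDerivAt_pi.2 fun r => hasDerivAt_pi.2 fun j => ?_
  have h := HasDerivAt.fun_sum (u := (Finset.univ : Finset μ)) (fun m _ => (hasDerivAt_entry hQ m j).const_mul (τ r m))
  simp only [Matrix.of_symm_apply, Matrix.mul_apply, Matrix.of_apply]
  exact h

omit [Fintype κ] in
/-- [folklore] **FIRST JET OF THE COMPOSITE SLICED BORDER**: `u ↦ [[Q₂Q₁; τ₂Q₁]; τ₁]` has derivative `[[Q̇₂Q₁ + Q₂Q̇₁; τ₂Q̇₁]; 0]`. -/
theorem hasDerivAt_compBorder {Q₁ : ℝ → μ → ν → ℝ} {Q₂ : ℝ → κ → μ → ℝ} {Q₁' : Matrix μ ν ℝ} {Q₂' : Matrix κ μ ℝ} {t : ℝ}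
    (τ₁ : Matrix ρ₁ ν ℝ) (τ₂ : Matrix ρ₂ μ ℝ) (hQ₁ : HasDerivAt Q₁ (Matrix.of.symm Q₁') t) (hQ₂ : HasDerivAt Q₂ (Matrix.of.symm Q₂') t) :
    HasDerivAt (fun u => Matrix.of.symm (fromRows (fromRows (Matrix.of (Q₂ u) * Matrix.of (Q₁ u)) (τ₂ * Matrix.of (Q₁ u))) τ₁))
      (Matrix.of.symm (fromRows (fromRows (Q₂' * Matrix.of (Q₁ t) + Matrix.of (Q₂ t) * Q₁') (τ₂ * Q₁')) (0 : Matrix ρ₁ ν ℝ))) t := by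
  have h12 := hasDerivAt_matMul hQ₂ hQ₁
  have hτ := hasDerivAt_const_mul τ₂ hQ₁
  refine hasDerivAt_pi.2 fun a => hasDerivAt_pi.2 fun j => ?_
  rcases a with (k | r₂) | r₁
  · simp only [Matrix.of_symm_apply, Matrix.fromRows_apply_inl]
    exact hasDerivAt_entry h12 k j
  · simp only [Matrix.of_symm_apply, Matrix.fromRows_apply_inl, Matrix.fromRows_apply_inr]
    exact hasDerivAt_entry hτ r₂ j
  · simp only [Matrix.of_symm_apply, Matrix.fromRows_apply_inr, Matrix.zero_apply]
    exact hasDerivAt_const _ _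

/-- [folklore] **SECOND JET OF THE COMPOSITE SLICED BORDER**: the first-jet curve `u ↦ [[Q₂d·Q₁ + Q₂·Q₁d; τ₂·Q₁d]; 0]` has derivative
`[[Q₂dd·Q₁ + Q₂d·Q₁d + (Q₂d·Q₁d + Q₂·Q₁dd); τ₂·Q₁dd]; 0]` at `t` (`Q₂dd`, `Q₁dd` the derivatives of the first-jet curves `Q₂d`, `Q₁d` at `t`). -/
theorem hasDerivAt_compBorderJet {Q₁ Q₁d : ℝ → μ → ν → ℝ} {Q₂ Q₂d : ℝ → κ → μ → ℝ} {Q₁dd : Matrix μ ν ℝ} {Q₂dd : Matrix κ μ ℝ} {t : ℝ}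
    (τ₂ : Matrix ρ₂ μ ℝ)
    (hQ₁ : HasDerivAt Q₁ (Q₁d t) t) (hQ₁d : HasDerivAt Q₁d (Matrix.of.symm Q₁dd) t)
    (hQ₂ : HasDerivAt Q₂ (Q₂d t) t) (hQ₂d : HasDerivAt Q₂d (Matrix.of.symm Q₂dd) t) :
    HasDerivAt (fun u => Matrix.of.symm (fromRows (fromRows (Matrix.of (Q₂d u) * Matrix.of (Q₁ u) + Matrix.of (Q₂ u) * Matrix.of (Q₁d u))
        (τ₂ * Matrix.of (Q₁d u))) (0 : Matrix ρ₁ ν ℝ)))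
      (Matrix.of.symm (fromRows (fromRows (Q₂dd * Matrix.of (Q₁ t) + Matrix.of (Q₂d t) * Matrix.of (Q₁d t)
          + (Matrix.of (Q₂d t) * Matrix.of (Q₁d t) + Matrix.of (Q₂ t) * Q₁dd)) (τ₂ * Q₁dd)) (0 : Matrix ρ₁ ν ℝ))) t := by
  have hQ₁' : HasDerivAt Q₁ (Matrix.of.symm (Matrix.of (Q₁d t))) t := hQ₁
  have hQ₂' : HasDerivAt Q₂ (Matrix.of.symm (Matrix.of (Q₂d t))) t := hQ₂
  have h12 := (hasDerivAt_matMul hQ₂d hQ₁').add (hasDerivAt_matMul hQ₂' hQ₁d)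
  have hτ := hasDerivAt_const_mul τ₂ hQ₁d
  refine hasDerivAt_pi.2 fun a => hasDerivAt_pi.2 fun j => ?_
  rcases a with (k | r₂) | r₁
  · simp only [Matrix.of_symm_apply, Matrix.fromRows_apply_inl, Matrix.add_apply]
    have h := hasDerivAt_entry h12 k j
    simp only [Pi.add_apply, Matrix.of_symm_apply, Matrix.add_apply] at h
    exact h
  · simp only [Matrix.of_symm_apply, Matrix.fromRows_apply_inl, Matrix.fromRows_apply_inr]
    exact hasDerivAt_entry hτ r₂ j
  · simp only [Matrix.of_symm_apply, Matrix.fromRows_apply_inr, Matrix.zero_apply]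
    exact hasDerivAt_const _ _

end Border

/-! ## §2 First jet of the composite sliced form `H + Q₁ᵀGQ₁` (the second jet is `NestedStepLawMovingBorder.hasDerivAt_compForm_curves_jet`) -/

section Form

variable {ν μ : Type*} [Fintype ν] [Fintype μ]

/-- [folklore] **FIRST JET OF THE COMPOSITE SLICED FORM**: `u ↦ H + Q₁ᵀGQ₁` has derivative `Ḣ + (Q̇₁ᵀGQ₁ + Q₁ᵀĠQ₁ + Q₁ᵀGQ̇₁)`. -/
theorem hasDerivAt_compFormSliced {H : ℝ → ν → ν → ℝ} {Q₁ : ℝ → μ → ν → ℝ} {G : ℝ → μ → μ → ℝ}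
    {H' : Matrix ν ν ℝ} {Q₁' : Matrix μ ν ℝ} {G' : Matrix μ μ ℝ} {t : ℝ}
    (hH : HasDerivAt H (Matrix.of.symm H') t) (hQ₁ : HasDerivAt Q₁ (Matrix.of.symm Q₁') t) (hG : HasDerivAt G (Matrix.of.symm G') t) :
    HasDerivAt (fun u => Matrix.of.symm (Matrix.of (H u) + (Matrix.of (Q₁ u))ᵀ * Matrix.of (G u) * Matrix.of (Q₁ u)))
      (Matrix.of.symm (H' + (Q₁'ᵀ * Matrix.of (G t) * Matrix.of (Q₁ t) + (Matrix.of (Q₁ t))ᵀ * G' * Matrix.of (Q₁ t)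
        + (Matrix.of (Q₁ t))ᵀ * Matrix.of (G t) * Q₁'))) t := by
  have h := hH.add (hasDerivAt_sandwich_curves hQ₁ hG hQ₁)
  refine HasDerivAt.congr_deriv (h.congr_of_eventuallyEq (Eventually.of_forall fun u => ?_)) ?_
  · funext i j
    simp only [Pi.add_apply, Matrix.of_symm_apply, Matrix.add_apply, Matrix.of_apply]
  · funext i j
    simp only [Pi.add_apply, Matrix.of_symm_apply, Matrix.add_apply]

end Form

/-! ## §3 Jets of the block curve `E = effForm H [Q₁;τ₁] + (G ⊕ 0)` -/

section Block

variable {ν μ ρ₁ : Type*} [Fintype ν] [Fintype μ] [Fintype ρ₁] [DecidableEq ν] [DecidableEq μ] [DecidableEq ρ₁]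

/-- [folklore] **FIRST JET OF THE BLOCK CURVE NEAR A NON-DEGENERATE POINT**: with `𝓘ᴸ_u, 𝓘_u, 𝔊_u` the blocks of the inverse of the fine sliced system
`kkt H(u) [Q₁(u);τ₁]`, the block curve `E(u) = 𝔊_u + (G(u) ⊕ 0)` has, at every `u` near `t`, derivative
`(𝓘ᴸ_u Ḣ(u) − 𝔊_u [Q̇₁(u);0]) 𝓘_u − 𝓘ᴸ_u [Q̇₁(u);0]ᵀ 𝔊_u + (Ġ(u) ⊕ 0)`. -/
theorem eventually_hasDerivAt_blockCurve {H H₁ : ℝ → ν → ν → ℝ} {Q₁ Q₁d : ℝ → μ → ν → ℝ} {G Gd : ℝ → μ → μ → ℝ} {t : ℝ} (τ₁ : Matrix ρ₁ ν ℝ)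
    (hH : ∀ᶠ u in 𝓝 t, HasDerivAt H (H₁ u) u) (hQ₁ : ∀ᶠ u in 𝓝 t, HasDerivAt Q₁ (Q₁d u) u) (hG : ∀ᶠ u in 𝓝 t, HasDerivAt G (Gd u) u)
    (hdet : (kkt (Matrix.of (H t)) (fromRows (Matrix.of (Q₁ t)) τ₁)).det ≠ 0) :
    ∀ᶠ u in 𝓝 t, HasDerivAt
      (fun v => Matrix.of.symm (effForm (Matrix.of (H v)) (fromRows (Matrix.of (Q₁ v)) τ₁)
        + fromBlocks (Matrix.of (G v)) (0 : Matrix μ ρ₁ ℝ) (0 : Matrix ρ₁ μ ℝ) (0 : Matrix ρ₁ ρ₁ ℝ)))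
      ((fun u => Matrix.of.symm
        ((minOpL (Matrix.of (H u)) (fromRows (Matrix.of (Q₁ u)) τ₁) * Matrix.of (H₁ u)
              - effForm (Matrix.of (H u)) (fromRows (Matrix.of (Q₁ u)) τ₁) * fromRows (Matrix.of (Q₁d u)) (0 : Matrix ρ₁ ν ℝ))
            * minOp (Matrix.of (H u)) (fromRows (Matrix.of (Q₁ u)) τ₁)
          - minOpL (Matrix.of (H u)) (fromRows (Matrix.of (Q₁ u)) τ₁) * (fromRows (Matrix.of (Q₁d u)) (0 : Matrix ρ₁ ν ℝ))ᵀ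
            * effForm (Matrix.of (H u)) (fromRows (Matrix.of (Q₁ u)) τ₁)
          + fromBlocks (Matrix.of (Gd u)) (0 : Matrix μ ρ₁ ℝ) (0 : Matrix ρ₁ μ ℝ) (0 : Matrix ρ₁ ρ₁ ℝ))) u) u := by
  -- the sliced fine constraint curve and its jet curve
  set Qf : ℝ → (μ ⊕ ρ₁) → ν → ℝ := fun u => Matrix.of.symm (fromRows (Matrix.of (Q₁ u)) τ₁) with hQf
  set Qfd : ℝ → (μ ⊕ ρ₁) → ν → ℝ := fun u => Matrix.of.symm (fromRows (Matrix.of (Q₁d u)) (0 : Matrix ρ₁ ν ℝ)) with hQfd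
  have hQf' : ∀ᶠ u in 𝓝 t, HasDerivAt Qf (Qfd u) u := by
    filter_upwards [hQ₁] with u hu
    have hu' : HasDerivAt Q₁ (Matrix.of.symm (Matrix.of (Q₁d u))) u := hu
    exact NestedStepLawSliced.hasDerivAt_fromRows_const τ₁ hu'
  have hdet' : (kkt (Matrix.of (H t)) (Matrix.of (Qf t))).det ≠ 0 := by rw [hQf]; simpa only [Equiv.apply_symm_apply] using hdet
  have hE := eventually_hasDerivAt_effForm hH hQf' hdet'
  filter_upwards [hE, hG] with u huE huG
  have huG' : HasDerivAt G (Matrix.of.symm (Matrix.of (Gd u))) u := huG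
  have h := huE.add (hasDerivAt_blockDiag (ρ₁ := ρ₁) huG')
  rw [hQf, hQfd] at h
  simp only [Equiv.apply_symm_apply] at h
  refine HasDerivAt.congr_deriv (h.congr_of_eventuallyEq (Eventually.of_forall fun v => ?_)) ?_
  · funext i j
    simp only [Pi.add_apply, Matrix.of_symm_apply, Matrix.add_apply]
  · funext i j
    simp only [Pi.add_apply, Matrix.of_symm_apply, Matrix.add_apply]

/-- [folklore] **SECOND JET OF THE BLOCK CURVE**: the derivative at `t` of the first-jet curve of `eventually_hasDerivAt_blockCurve`, by
`EffectiveFormJetsMovingBorder.hasDerivAt_effFormJet` (blocks `Γ, 𝓘, 𝓘ᴸ, 𝔊` of the inverse of `kkt H(t) [Q₁(t);τ₁]` and the jets `A = Ḣ(t)`, `B = [Q̇₁(t);0]`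
NAMED) plus the block term's second jet `G₂ ⊕ 0`. -/
theorem hasDerivAt_blockCurveJet {H H₁ : ℝ → ν → ν → ℝ} {H₂ : Matrix ν ν ℝ} {Q₁ Q₁d : ℝ → μ → ν → ℝ} {Q₁dd : Matrix μ ν ℝ}
    {Gd : ℝ → μ → μ → ℝ} {Gdd : Matrix μ μ ℝ} {t : ℝ} (τ₁ : Matrix ρ₁ ν ℝ)
    (hH : HasDerivAt H (H₁ t) t) (hH₁ : HasDerivAt H₁ (Matrix.of.symm H₂) t)
    (hQ₁ : HasDerivAt Q₁ (Q₁d t) t) (hQ₁d : HasDerivAt Q₁d (Matrix.of.symm Q₁dd) t)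
    (hGd : HasDerivAt Gd (Matrix.of.symm Gdd) t)
    (hdet : (kkt (Matrix.of (H t)) (fromRows (Matrix.of (Q₁ t)) τ₁)).det ≠ 0)
    {Γ : Matrix ν ν ℝ} {I : Matrix ν (μ ⊕ ρ₁) ℝ} {L : Matrix (μ ⊕ ρ₁) ν ℝ} {S : Matrix (μ ⊕ ρ₁) (μ ⊕ ρ₁) ℝ} {A : Matrix ν ν ℝ} {B : Matrix (μ ⊕ ρ₁) ν ℝ}
    (hΓ : flucCov (Matrix.of (H t)) (fromRows (Matrix.of (Q₁ t)) τ₁) = Γ) (hI : minOp (Matrix.of (H t)) (fromRows (Matrix.of (Q₁ t)) τ₁) = I)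
    (hL : minOpL (Matrix.of (H t)) (fromRows (Matrix.of (Q₁ t)) τ₁) = L) (hS : effForm (Matrix.of (H t)) (fromRows (Matrix.of (Q₁ t)) τ₁) = S)
    (hA : Matrix.of (H₁ t) = A) (hB : fromRows (Matrix.of (Q₁d t)) (0 : Matrix ρ₁ ν ℝ) = B) :
    HasDerivAt
      (fun u => Matrix.of.symm
        ((minOpL (Matrix.of (H u)) (fromRows (Matrix.of (Q₁ u)) τ₁) * Matrix.of (H₁ u)
              - effForm (Matrix.of (H u)) (fromRows (Matrix.of (Q₁ u)) τ₁) * fromRows (Matrix.of (Q₁d u)) (0 : Matrix ρ₁ ν ℝ))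
            * minOp (Matrix.of (H u)) (fromRows (Matrix.of (Q₁ u)) τ₁)
          - minOpL (Matrix.of (H u)) (fromRows (Matrix.of (Q₁ u)) τ₁) * (fromRows (Matrix.of (Q₁d u)) (0 : Matrix ρ₁ ν ℝ))ᵀ
            * effForm (Matrix.of (H u)) (fromRows (Matrix.of (Q₁ u)) τ₁)
          + fromBlocks (Matrix.of (Gd u)) (0 : Matrix μ ρ₁ ℝ) (0 : Matrix ρ₁ μ ℝ) (0 : Matrix ρ₁ ρ₁ ℝ)))
      (Matrix.of.symm
        (((-((L * A - S * B) * Γ + L * Bᵀ * L) * A + L * H₂ - (((L * A - S * B) * I - L * Bᵀ * S) * B + S * fromRows Q₁dd (0 : Matrix ρ₁ ν ℝ))) * I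
            + (L * A - S * B) * (-((Γ * A + I * B) * I - Γ * Bᵀ * S)))
          - ((-((L * A - S * B) * Γ + L * Bᵀ * L) * Bᵀ + L * (fromRows Q₁dd (0 : Matrix ρ₁ ν ℝ))ᵀ) * S + L * Bᵀ * ((L * A - S * B) * I - L * Bᵀ * S))
          + fromBlocks Gdd (0 : Matrix μ ρ₁ ℝ) (0 : Matrix ρ₁ μ ℝ) (0 : Matrix ρ₁ ρ₁ ℝ))) t := by
  set Qf : ℝ → (μ ⊕ ρ₁) → ν → ℝ := fun u => Matrix.of.symm (fromRows (Matrix.of (Q₁ u)) τ₁) with hQf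
  set Qfd : ℝ → (μ ⊕ ρ₁) → ν → ℝ := fun u => Matrix.of.symm (fromRows (Matrix.of (Q₁d u)) (0 : Matrix ρ₁ ν ℝ)) with hQfd
  have hQ₁' : HasDerivAt Q₁ (Matrix.of.symm (Matrix.of (Q₁d t))) t := hQ₁
  have hQf' : HasDerivAt Qf (Qfd t) t := NestedStepLawSliced.hasDerivAt_fromRows_const τ₁ hQ₁'
  have hQfd' : HasDerivAt Qfd (Matrix.of.symm (fromRows Q₁dd (0 : Matrix ρ₁ ν ℝ))) t :=
    NestedStepLawSliced.hasDerivAt_fromRows_const (0 : Matrix ρ₁ ν ℝ) hQ₁d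
  have hdet' : (kkt (Matrix.of (H t)) (Matrix.of (Qf t))).det ≠ 0 := by rw [hQf]; simpa only [Equiv.apply_symm_apply] using hdet
  have hΓ' : flucCov (Matrix.of (H t)) (Matrix.of (Qf t)) = Γ := by rw [hQf]; simpa only [Equiv.apply_symm_apply] using hΓ
  have hI' : minOp (Matrix.of (H t)) (Matrix.of (Qf t)) = I := by rw [hQf]; simpa only [Equiv.apply_symm_apply] using hI
  have hL' : minOpL (Matrix.of (H t)) (Matrix.of (Qf t)) = L := by rw [hQf]; simpa only [Equiv.apply_symm_apply] using hL
  have hS' : effForm (Matrix.of (H t)) (Matrix.of (Qf t)) = S := by rw [hQf]; simpa only [Equiv.apply_symm_apply] using hS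
  have hB' : Matrix.of (Qfd t) = B := by rw [hQfd]; simpa only [Equiv.apply_symm_apply] using hB
  have hJ := hasDerivAt_effFormJet hH hH₁ hQf' hQfd' hdet' hΓ' hI' hL' hS' hA hB'
  have h := hJ.add (hasDerivAt_blockDiag (ρ₁ := ρ₁) hGd)
  rw [hQf, hQfd] at h
  simp only [Equiv.apply_symm_apply] at h
  refine HasDerivAt.congr_deriv (h.congr_of_eventuallyEq (Eventually.of_forall fun v => ?_)) ?_
  · funext i j
    simp only [Pi.add_apply, Matrix.of_symm_apply, Matrix.add_apply]
  · funext i j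
    simp only [Pi.add_apply, Matrix.of_symm_apply, Matrix.add_apply]

end Block

/-! ## §4 The nested step law with every jet displayed -/

section Law

variable {ν μ κ ρ₁ ρ₂ : Type*} [Fintype ν] [Fintype μ] [Fintype κ] [Fintype ρ₁] [Fintype ρ₂]
  [DecidableEq ν] [DecidableEq μ] [DecidableEq κ] [DecidableEq ρ₁] [DecidableEq ρ₂]

/-- [folklore] **THE NESTED STEP LAW FOR SLICED SYSTEMS, JET FORM.**  Data: `C²` curves `H, Q₁, Q₂, G` near `0` with first-jet curves `H₁, Q₁d, Q₂d, Gd` and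
second jets `H₂, Q₁dd, Q₂dd, Gdd` at `0`; static slices `τ₁, τ₂`; the values and first jets at `0` NAMED (`H₀, H₁₀, Q₁₀, Q₁₁, Q₂₀, Q₂₁, G₀, G₁`); the blocks
`Γ, 𝓘, 𝓘ᴸ, 𝔊` of the inverse of the fine sliced system `kkt H₀ [Q₁₀;τ₁]` and the sliced border jet `B = [Q₁₁;0]` NAMED; the fine sliced system and the block system
`kkt (𝔊 + (G₀ ⊕ 0)) [[Q₂₀,0],[τ₂,0],[0,1]]` non-degenerate.  CONCLUSION: the second variation at `0` of `log|det kkt (H + Q₁ᵀGQ₁) [[Q₂Q₁; τ₂Q₁]; τ₁]|` — composite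
form and border jets DISPLAYED (§1–§2) — equals that of the fine sliced system `kkt H [Q₁;τ₁]` plus that of the block system, whose form jets are the DISPLAYED words
of §3 (`(𝓘ᴸH₁₀ − 𝔊B)𝓘 − 𝓘ᴸBᵀ𝔊 + (G₁ ⊕ 0)` and the second-jet word) and whose border jets are `[[Q₂₁,0],[0,0],[0,0]]`, `[[Q₂dd,0],[0,0],[0,0]]`.  ZERO STEP DEFECT. -/
theorem secondVar_nestedStepLaw_jets
    {H H₁ : ℝ → ν → ν → ℝ} {H₂ : Matrix ν ν ℝ} {Q₁ Q₁d : ℝ → μ → ν → ℝ} {Q₁dd : Matrix μ ν ℝ} {Q₂ Q₂d : ℝ → κ → μ → ℝ} {Q₂dd : Matrix κ μ ℝ}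
    {G Gd : ℝ → μ → μ → ℝ} {Gdd : Matrix μ μ ℝ}
    (hH : ∀ᶠ u in 𝓝 (0 : ℝ), HasDerivAt H (H₁ u) u) (hH₁ : HasDerivAt H₁ (Matrix.of.symm H₂) 0)
    (hQ₁ : ∀ᶠ u in 𝓝 (0 : ℝ), HasDerivAt Q₁ (Q₁d u) u) (hQ₁d : HasDerivAt Q₁d (Matrix.of.symm Q₁dd) 0)
    (hQ₂ : ∀ᶠ u in 𝓝 (0 : ℝ), HasDerivAt Q₂ (Q₂d u) u) (hQ₂d : HasDerivAt Q₂d (Matrix.of.symm Q₂dd) 0)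
    (hG : ∀ᶠ u in 𝓝 (0 : ℝ), HasDerivAt G (Gd u) u) (hGd : HasDerivAt Gd (Matrix.of.symm Gdd) 0)
    (τ₁ : Matrix ρ₁ ν ℝ) (τ₂ : Matrix ρ₂ μ ℝ)
    -- values and first jets at `0`, NAMED
    {H₀ H₁₀ : Matrix ν ν ℝ} {Q₁₀ Q₁₁ : Matrix μ ν ℝ} {Q₂₀ Q₂₁ : Matrix κ μ ℝ} {G₀ G₁ : Matrix μ μ ℝ}
    (hH₀ : Matrix.of (H 0) = H₀) (hH₁₀ : Matrix.of (H₁ 0) = H₁₀) (hQ₁₀ : Matrix.of (Q₁ 0) = Q₁₀) (hQ₁₁ : Matrix.of (Q₁d 0) = Q₁₁)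
    (hQ₂₀ : Matrix.of (Q₂ 0) = Q₂₀) (hQ₂₁ : Matrix.of (Q₂d 0) = Q₂₁) (hG₀ : Matrix.of (G 0) = G₀) (hG₁ : Matrix.of (Gd 0) = G₁)
    -- blocks of the inverse of the fine sliced system at `0` and the sliced border jet, NAMED
    {Γ : Matrix ν ν ℝ} {I : Matrix ν (μ ⊕ ρ₁) ℝ} {L : Matrix (μ ⊕ ρ₁) ν ℝ} {S : Matrix (μ ⊕ ρ₁) (μ ⊕ ρ₁) ℝ} {B : Matrix (μ ⊕ ρ₁) ν ℝ}
    (hΓ : flucCov H₀ (fromRows Q₁₀ τ₁) = Γ) (hI : minOp H₀ (fromRows Q₁₀ τ₁) = I) (hL : minOpL H₀ (fromRows Q₁₀ τ₁) = L) (hS : effForm H₀ (fromRows Q₁₀ τ₁) = S)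
    (hB : fromRows Q₁₁ (0 : Matrix ρ₁ ν ℝ) = B)
    (h1 : (kkt H₀ (fromRows Q₁₀ τ₁)).det ≠ 0)
    (h2 : (kkt (S + fromBlocks G₀ (0 : Matrix μ ρ₁ ℝ) (0 : Matrix ρ₁ μ ℝ) (0 : Matrix ρ₁ ρ₁ ℝ))
      (fromBlocks (fromRows Q₂₀ τ₂) (0 : Matrix (κ ⊕ ρ₂) ρ₁ ℝ) (0 : Matrix ρ₁ μ ℝ) (1 : Matrix ρ₁ ρ₁ ℝ))).det ≠ 0) :
    secondVar
        (kkt (H₀ + Q₁₀ᵀ * G₀ * Q₁₀) (fromRows (fromRows (Q₂₀ * Q₁₀) (τ₂ * Q₁₀)) τ₁))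
        (kkt (H₁₀ + (Q₁₁ᵀ * G₀ * Q₁₀ + Q₁₀ᵀ * G₁ * Q₁₀ + Q₁₀ᵀ * G₀ * Q₁₁)) (fromRows (fromRows (Q₂₁ * Q₁₀ + Q₂₀ * Q₁₁) (τ₂ * Q₁₁)) (0 : Matrix ρ₁ ν ℝ)))
        (kkt (H₂ + ((Q₁ddᵀ * G₀ * Q₁₀ + Q₁₁ᵀ * G₁ * Q₁₀ + Q₁₁ᵀ * G₀ * Q₁₁) + (Q₁₁ᵀ * G₁ * Q₁₀ + Q₁₀ᵀ * Gdd * Q₁₀ + Q₁₀ᵀ * G₁ * Q₁₁)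
            + (Q₁₁ᵀ * G₀ * Q₁₁ + Q₁₀ᵀ * G₁ * Q₁₁ + Q₁₀ᵀ * G₀ * Q₁dd)))
          (fromRows (fromRows (Q₂dd * Q₁₀ + Q₂₁ * Q₁₁ + (Q₂₁ * Q₁₁ + Q₂₀ * Q₁dd)) (τ₂ * Q₁dd)) (0 : Matrix ρ₁ ν ℝ)))
      = secondVar (kkt H₀ (fromRows Q₁₀ τ₁)) (kkt H₁₀ B) (kkt H₂ (fromRows Q₁dd (0 : Matrix ρ₁ ν ℝ)))
        + secondVar
            (kkt (S + fromBlocks G₀ (0 : Matrix μ ρ₁ ℝ) (0 : Matrix ρ₁ μ ℝ) (0 : Matrix ρ₁ ρ₁ ℝ))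
              (fromBlocks (fromRows Q₂₀ τ₂) (0 : Matrix (κ ⊕ ρ₂) ρ₁ ℝ) (0 : Matrix ρ₁ μ ℝ) (1 : Matrix ρ₁ ρ₁ ℝ)))
            (kkt ((L * H₁₀ - S * B) * I - L * Bᵀ * S + fromBlocks G₁ (0 : Matrix μ ρ₁ ℝ) (0 : Matrix ρ₁ μ ℝ) (0 : Matrix ρ₁ ρ₁ ℝ))
              (fromBlocks (fromRows Q₂₁ (0 : Matrix ρ₂ μ ℝ)) (0 : Matrix (κ ⊕ ρ₂) ρ₁ ℝ) (0 : Matrix ρ₁ μ ℝ) (0 : Matrix ρ₁ ρ₁ ℝ)))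
            (kkt ((((-((L * H₁₀ - S * B) * Γ + L * Bᵀ * L) * H₁₀ + L * H₂
                      - (((L * H₁₀ - S * B) * I - L * Bᵀ * S) * B + S * fromRows Q₁dd (0 : Matrix ρ₁ ν ℝ))) * I
                    + (L * H₁₀ - S * B) * (-((Γ * H₁₀ + I * B) * I - Γ * Bᵀ * S)))
                  - ((-((L * H₁₀ - S * B) * Γ + L * Bᵀ * L) * Bᵀ + L * (fromRows Q₁dd (0 : Matrix ρ₁ ν ℝ))ᵀ) * S
                      + L * Bᵀ * ((L * H₁₀ - S * B) * I - L * Bᵀ * S))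
                  + fromBlocks Gdd (0 : Matrix μ ρ₁ ℝ) (0 : Matrix ρ₁ μ ℝ) (0 : Matrix ρ₁ ρ₁ ℝ)))
              (fromBlocks (fromRows Q₂dd (0 : Matrix ρ₂ μ ℝ)) (0 : Matrix (κ ⊕ ρ₂) ρ₁ ℝ) (0 : Matrix ρ₁ μ ℝ) (0 : Matrix ρ₁ ρ₁ ℝ))) := by
  -- jets at `0` in curve form
  have hH0 : HasDerivAt H (H₁ 0) 0 := hH.self_of_nhds
  have hQ₁0 : HasDerivAt Q₁ (Q₁d 0) 0 := hQ₁.self_of_nhds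
  have hQ₂0 : HasDerivAt Q₂ (Q₂d 0) 0 := hQ₂.self_of_nhds
  have hG0 : HasDerivAt G (Gd 0) 0 := hG.self_of_nhds
  -- raw forms of the named hypotheses
  have h1' : (kkt (Matrix.of (H 0)) (fromRows (Matrix.of (Q₁ 0)) τ₁)).det ≠ 0 := by rw [hH₀, hQ₁₀]; exact h1
  have hΓ' : flucCov (Matrix.of (H 0)) (fromRows (Matrix.of (Q₁ 0)) τ₁) = Γ := by rw [hH₀, hQ₁₀]; exact hΓ
  have hI' : minOp (Matrix.of (H 0)) (fromRows (Matrix.of (Q₁ 0)) τ₁) = I := by rw [hH₀, hQ₁₀]; exact hI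
  have hL' : minOpL (Matrix.of (H 0)) (fromRows (Matrix.of (Q₁ 0)) τ₁) = L := by rw [hH₀, hQ₁₀]; exact hL
  have hS' : effForm (Matrix.of (H 0)) (fromRows (Matrix.of (Q₁ 0)) τ₁) = S := by rw [hH₀, hQ₁₀]; exact hS
  have hB' : fromRows (Matrix.of (Q₁d 0)) (0 : Matrix ρ₁ ν ℝ) = B := by rw [hQ₁₁]; exact hB
  -- §3: the block curve and its jets
  have hE := eventually_hasDerivAt_blockCurve τ₁ hH hQ₁ hG h1'
  have hE₁ := hasDerivAt_blockCurveJet τ₁ hH0 hH₁ hQ₁0 hQ₁d hGd h1' hΓ' hI' hL' hS' hH₁₀ hB'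
  have hEeq : ∀ᶠ u in 𝓝 (0 : ℝ), Matrix.of ((fun v => Matrix.of.symm (effForm (Matrix.of (H v)) (fromRows (Matrix.of (Q₁ v)) τ₁)
      + fromBlocks (Matrix.of (G v)) (0 : Matrix μ ρ₁ ℝ) (0 : Matrix ρ₁ μ ℝ) (0 : Matrix ρ₁ ρ₁ ℝ))) u)
      = effForm (Matrix.of (H u)) (fromRows (Matrix.of (Q₁ u)) τ₁)
        + fromBlocks (Matrix.of (G u)) (0 : Matrix μ ρ₁ ℝ) (0 : Matrix ρ₁ μ ℝ) (0 : Matrix ρ₁ ρ₁ ℝ) :=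
    Eventually.of_forall fun u => by simp only [Equiv.apply_symm_apply]
  -- §2: the composite form and its jets
  have h𝔎 : ∀ᶠ u in 𝓝 (0 : ℝ), HasDerivAt (fun v => Matrix.of.symm (Matrix.of (H v) + (Matrix.of (Q₁ v))ᵀ * Matrix.of (G v) * Matrix.of (Q₁ v)))
      ((fun u => Matrix.of.symm (Matrix.of (H₁ u) + ((Matrix.of (Q₁d u))ᵀ * Matrix.of (G u) * Matrix.of (Q₁ u)
        + (Matrix.of (Q₁ u))ᵀ * Matrix.of (Gd u) * Matrix.of (Q₁ u) + (Matrix.of (Q₁ u))ᵀ * Matrix.of (G u) * Matrix.of (Q₁d u)))) u) u := by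
    filter_upwards [hH, hQ₁, hG] with u huH huQ huG
    have huH' : HasDerivAt H (Matrix.of.symm (Matrix.of (H₁ u))) u := huH
    have huQ' : HasDerivAt Q₁ (Matrix.of.symm (Matrix.of (Q₁d u))) u := huQ
    have huG' : HasDerivAt G (Matrix.of.symm (Matrix.of (Gd u))) u := huG
    exact hasDerivAt_compFormSliced huH' huQ' huG'
  have h𝔎₁ := hasDerivAt_compForm_curves_jet hH₁ hQ₁0 hQ₁d hG0 hGd
  have h𝔎eq : ∀ᶠ u in 𝓝 (0 : ℝ), Matrix.of ((fun v => Matrix.of.symm (Matrix.of (H v) + (Matrix.of (Q₁ v))ᵀ * Matrix.of (G v) * Matrix.of (Q₁ v))) u)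
      = Matrix.of (H u) + (Matrix.of (Q₁ u))ᵀ * Matrix.of (G u) * Matrix.of (Q₁ u) :=
    Eventually.of_forall fun u => by simp only [Equiv.apply_symm_apply]
  -- §1: the composite border and its jets
  have h𝔔 : ∀ᶠ u in 𝓝 (0 : ℝ), HasDerivAt (fun v => Matrix.of.symm (fromRows (fromRows (Matrix.of (Q₂ v) * Matrix.of (Q₁ v)) (τ₂ * Matrix.of (Q₁ v))) τ₁))
      ((fun u => Matrix.of.symm (fromRows (fromRows (Matrix.of (Q₂d u) * Matrix.of (Q₁ u) + Matrix.of (Q₂ u) * Matrix.of (Q₁d u))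
        (τ₂ * Matrix.of (Q₁d u))) (0 : Matrix ρ₁ ν ℝ))) u) u := by
    filter_upwards [hQ₁, hQ₂] with u huQ₁ huQ₂
    have huQ₁' : HasDerivAt Q₁ (Matrix.of.symm (Matrix.of (Q₁d u))) u := huQ₁
    have huQ₂' : HasDerivAt Q₂ (Matrix.of.symm (Matrix.of (Q₂d u))) u := huQ₂
    exact hasDerivAt_compBorder τ₁ τ₂ huQ₁' huQ₂'
  have h𝔔₁ := hasDerivAt_compBorderJet (ρ₁ := ρ₁) τ₂ hQ₁0 hQ₁d hQ₂0 hQ₂d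
  have h𝔔eq : ∀ᶠ u in 𝓝 (0 : ℝ),
      Matrix.of ((fun v => Matrix.of.symm (fromRows (fromRows (Matrix.of (Q₂ v) * Matrix.of (Q₁ v)) (τ₂ * Matrix.of (Q₁ v))) τ₁)) u)
      = fromRows (fromRows (Matrix.of (Q₂ u) * Matrix.of (Q₁ u)) (τ₂ * Matrix.of (Q₁ u))) τ₁ :=
    Eventually.of_forall fun u => by simp only [Equiv.apply_symm_apply]
  -- the block system is non-degenerate (raw form)
  have h2' : (kkt (Matrix.of ((fun v => Matrix.of.symm (effForm (Matrix.of (H v)) (fromRows (Matrix.of (Q₁ v)) τ₁)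
      + fromBlocks (Matrix.of (G v)) (0 : Matrix μ ρ₁ ℝ) (0 : Matrix ρ₁ μ ℝ) (0 : Matrix ρ₁ ρ₁ ℝ))) 0))
      (fromBlocks (fromRows (Matrix.of (Q₂ 0)) τ₂) (0 : Matrix (κ ⊕ ρ₂) ρ₁ ℝ) (0 : Matrix ρ₁ μ ℝ) (1 : Matrix ρ₁ ρ₁ ℝ))).det ≠ 0 := by
    simp only [Equiv.apply_symm_apply, hH₀, hQ₁₀, hQ₂₀, hG₀, hS]; exact h2
  have h := secondVar_nestedStepLaw_sliced hH hH₁ hQ₁ hQ₁d hQ₂ hQ₂d τ₁ τ₂ hE hE₁ hEeq h𝔎 h𝔎₁ h𝔔 h𝔔₁ h𝔎eq h𝔔eq h1' h2'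
  simp only [Equiv.apply_symm_apply, hH₀, hH₁₀, hQ₁₀, hQ₁₁, hQ₂₀, hQ₂₁, hG₀, hG₁] at h
  simp only [hS, hI, hL, hB] at h
  exact h

end Law

/-! ## §5 Quadratic polynomial curves: the analysis-free form (twelve matrices, two slices, two invertibilities) -/

section Polynomial

variable {m n : Type*} [Fintype m] [Fintype n]

omit [Fintype m] in
/-- [folklore] the quadratic curve `u ↦ X₀ + uX₁ + ½u²X₂` has derivative `X₁ + uX₂` at `u`. -/
theorem hasDerivAt_quadCurve (X₀ X₁ X₂ : Matrix m n ℝ) (u : ℝ) :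
    HasDerivAt (fun v : ℝ => Matrix.of.symm (X₀ + v • X₁ + (v ^ 2 / 2) • X₂)) ((fun v : ℝ => Matrix.of.symm (X₁ + v • X₂)) u) u := by
  refine hasDerivAt_pi.2 fun i => hasDerivAt_pi.2 fun j => ?_
  simp only [Matrix.of_symm_apply, Matrix.add_apply, Matrix.smul_apply, smul_eq_mul]
  have h1 : HasDerivAt (fun v : ℝ => v * X₁ i j) (1 * X₁ i j) u := (hasDerivAt_id u).mul_const _
  have h2 : HasDerivAt (fun v : ℝ => v ^ 2 / 2 * X₂ i j) (((2 : ℕ) : ℝ) * u ^ (2 - 1) / 2 * X₂ i j) u :=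
    ((hasDerivAt_pow 2 u).div_const 2).mul_const _
  have h := (h1.const_add (X₀ i j)).add h2
  convert h using 1
  · funext x
    simp only [Pi.add_apply]
  · push_cast
    ring

omit [Fintype m] in
/-- [folklore] the linear curve `u ↦ X₁ + uX₂` has derivative `X₂`. -/
theorem hasDerivAt_linCurve (X₁ X₂ : Matrix m n ℝ) (u : ℝ) :
    HasDerivAt (fun v : ℝ => Matrix.of.symm (X₁ + v • X₂)) (Matrix.of.symm X₂) u := by
  refine hasDerivAt_pi.2 fun i => hasDerivAt_pi.2 fun j => ?_
  simp only [Matrix.of_symm_apply, Matrix.add_apply, Matrix.smul_apply, smul_eq_mul]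
  have h := ((hasDerivAt_id u).mul_const (X₂ i j)).const_add (X₁ i j)
  simpa only [id_eq, one_mul] using h

variable {ν μ κ ρ₁ ρ₂ : Type*} [Fintype ν] [Fintype μ] [Fintype κ] [Fintype ρ₁] [Fintype ρ₂]
  [DecidableEq ν] [DecidableEq μ] [DecidableEq κ] [DecidableEq ρ₁] [DecidableEq ρ₂]

/-- [folklore] **THE NESTED STEP LAW FOR SLICED SYSTEMS — ANALYSIS-FREE FORM (route T's target shape).**  DATA: twelve matrices — fine form jets `H₀, H₁, H₂`,
one-step averaging jets `Q₁₀, Q₁₁, Q₁₂`, coarse averaging jets `Q₂₀, Q₂₁, Q₂₂`, block-term jets `G₀, G₁, G₂` — two static slices `τ₁, τ₂`, the blocks `Γ, 𝓘, 𝓘ᴸ, 𝔊`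
of the inverse of the fine sliced system `kkt H₀ [Q₁₀;τ₁]` and `B = [Q₁₁;0]` NAMED, and the two invertibilities.  CONCLUSION: the identity of
`secondVar_nestedStepLaw_jets` among these matrices — NO curve, NO derivative, NO filter in the statement (the proof runs the jet form along the quadratic
curves `X₀ + uX₁ + ½u²X₂`).  On the torus (row (T-INST-j)) the twelve matrices are the periodised level-`j` tables and insertion families (row (T-ID)); the
block system is the (j+1, m) sliced system after `KKTCornerReduction` kills the `ρ₁`-corner. -/
theorem secondVar_nestedStepLaw_polynomial
    (H₀ H₁ H₂ : Matrix ν ν ℝ) (Q₁₀ Q₁₁ Q₁₂ : Matrix μ ν ℝ) (Q₂₀ Q₂₁ Q₂₂ : Matrix κ μ ℝ) (G₀ G₁ G₂ : Matrix μ μ ℝ)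
    (τ₁ : Matrix ρ₁ ν ℝ) (τ₂ : Matrix ρ₂ μ ℝ)
    {Γ : Matrix ν ν ℝ} {I : Matrix ν (μ ⊕ ρ₁) ℝ} {L : Matrix (μ ⊕ ρ₁) ν ℝ} {S : Matrix (μ ⊕ ρ₁) (μ ⊕ ρ₁) ℝ} {B : Matrix (μ ⊕ ρ₁) ν ℝ}
    (hΓ : flucCov H₀ (fromRows Q₁₀ τ₁) = Γ) (hI : minOp H₀ (fromRows Q₁₀ τ₁) = I) (hL : minOpL H₀ (fromRows Q₁₀ τ₁) = L) (hS : effForm H₀ (fromRows Q₁₀ τ₁) = S)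
    (hB : fromRows Q₁₁ (0 : Matrix ρ₁ ν ℝ) = B)
    (h1 : (kkt H₀ (fromRows Q₁₀ τ₁)).det ≠ 0)
    (h2 : (kkt (S + fromBlocks G₀ (0 : Matrix μ ρ₁ ℝ) (0 : Matrix ρ₁ μ ℝ) (0 : Matrix ρ₁ ρ₁ ℝ))
      (fromBlocks (fromRows Q₂₀ τ₂) (0 : Matrix (κ ⊕ ρ₂) ρ₁ ℝ) (0 : Matrix ρ₁ μ ℝ) (1 : Matrix ρ₁ ρ₁ ℝ))).det ≠ 0) :
    secondVar
        (kkt (H₀ + Q₁₀ᵀ * G₀ * Q₁₀) (fromRows (fromRows (Q₂₀ * Q₁₀) (τ₂ * Q₁₀)) τ₁))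
        (kkt (H₁ + (Q₁₁ᵀ * G₀ * Q₁₀ + Q₁₀ᵀ * G₁ * Q₁₀ + Q₁₀ᵀ * G₀ * Q₁₁)) (fromRows (fromRows (Q₂₁ * Q₁₀ + Q₂₀ * Q₁₁) (τ₂ * Q₁₁)) (0 : Matrix ρ₁ ν ℝ)))
        (kkt (H₂ + ((Q₁₂ᵀ * G₀ * Q₁₀ + Q₁₁ᵀ * G₁ * Q₁₀ + Q₁₁ᵀ * G₀ * Q₁₁) + (Q₁₁ᵀ * G₁ * Q₁₀ + Q₁₀ᵀ * G₂ * Q₁₀ + Q₁₀ᵀ * G₁ * Q₁₁)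
            + (Q₁₁ᵀ * G₀ * Q₁₁ + Q₁₀ᵀ * G₁ * Q₁₁ + Q₁₀ᵀ * G₀ * Q₁₂)))
          (fromRows (fromRows (Q₂₂ * Q₁₀ + Q₂₁ * Q₁₁ + (Q₂₁ * Q₁₁ + Q₂₀ * Q₁₂)) (τ₂ * Q₁₂)) (0 : Matrix ρ₁ ν ℝ)))
      = secondVar (kkt H₀ (fromRows Q₁₀ τ₁)) (kkt H₁ B) (kkt H₂ (fromRows Q₁₂ (0 : Matrix ρ₁ ν ℝ)))
        + secondVar
            (kkt (S + fromBlocks G₀ (0 : Matrix μ ρ₁ ℝ) (0 : Matrix ρ₁ μ ℝ) (0 : Matrix ρ₁ ρ₁ ℝ))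
              (fromBlocks (fromRows Q₂₀ τ₂) (0 : Matrix (κ ⊕ ρ₂) ρ₁ ℝ) (0 : Matrix ρ₁ μ ℝ) (1 : Matrix ρ₁ ρ₁ ℝ)))
            (kkt ((L * H₁ - S * B) * I - L * Bᵀ * S + fromBlocks G₁ (0 : Matrix μ ρ₁ ℝ) (0 : Matrix ρ₁ μ ℝ) (0 : Matrix ρ₁ ρ₁ ℝ))
              (fromBlocks (fromRows Q₂₁ (0 : Matrix ρ₂ μ ℝ)) (0 : Matrix (κ ⊕ ρ₂) ρ₁ ℝ) (0 : Matrix ρ₁ μ ℝ) (0 : Matrix ρ₁ ρ₁ ℝ)))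
            (kkt ((((-((L * H₁ - S * B) * Γ + L * Bᵀ * L) * H₁ + L * H₂
                      - (((L * H₁ - S * B) * I - L * Bᵀ * S) * B + S * fromRows Q₁₂ (0 : Matrix ρ₁ ν ℝ))) * I
                    + (L * H₁ - S * B) * (-((Γ * H₁ + I * B) * I - Γ * Bᵀ * S)))
                  - ((-((L * H₁ - S * B) * Γ + L * Bᵀ * L) * Bᵀ + L * (fromRows Q₁₂ (0 : Matrix ρ₁ ν ℝ))ᵀ) * S
                      + L * Bᵀ * ((L * H₁ - S * B) * I - L * Bᵀ * S))
                  + fromBlocks G₂ (0 : Matrix μ ρ₁ ℝ) (0 : Matrix ρ₁ μ ℝ) (0 : Matrix ρ₁ ρ₁ ℝ)))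
              (fromBlocks (fromRows Q₂₂ (0 : Matrix ρ₂ μ ℝ)) (0 : Matrix (κ ⊕ ρ₂) ρ₁ ℝ) (0 : Matrix ρ₁ μ ℝ) (0 : Matrix ρ₁ ρ₁ ℝ))) :=
  secondVar_nestedStepLaw_jets
    (Eventually.of_forall (hasDerivAt_quadCurve H₀ H₁ H₂)) (hasDerivAt_linCurve H₁ H₂ 0)
    (Eventually.of_forall (hasDerivAt_quadCurve Q₁₀ Q₁₁ Q₁₂)) (hasDerivAt_linCurve Q₁₁ Q₁₂ 0)
    (Eventually.of_forall (hasDerivAt_quadCurve Q₂₀ Q₂₁ Q₂₂)) (hasDerivAt_linCurve Q₂₁ Q₂₂ 0)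
    (Eventually.of_forall (hasDerivAt_quadCurve G₀ G₁ G₂)) (hasDerivAt_linCurve G₁ G₂ 0)
    τ₁ τ₂ (by simp) (by simp) (by simp) (by simp) (by simp) (by simp) (by simp) (by simp) hΓ hI hL hS hB h1 h2

end Polynomial

end Summit.QuantumFields.BalabanUV.Beta.FP.NestedStepLawJets

end
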